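import Summits.QuantumFields.YangMills.Theorems.AllWindowsColdBoxBoxHighWindowsSU22LineDefs
import Summits.QuantumFields.YangMills.Theorems.AllWindowsColdBoxBoxHighLineHodgePoincareFun

/-!
# LINE-19 «landau-sector-relative-bl», registered stub S1 BY NAME: `stub_hodgePoincare : HodgePoincareColdBox`
# (crux `AllWindowsColdBox.BoxHighWindowsSU22`, stmt-QuantumFields-24004; low item stmt-QuantumFields-24335)

**Theorem (Hodge–Poincaré inequality of the cold box).**  For every `H ≥ 1` and every real configuration `v` on the edges of
the cold box `Λ = [0,2H]⁴`,
`(1/344)/H² · ‖v‖² ≤ vᵀ · hodgeQ H · v`,   `hodgeQ H = Q_L + Σ_{x interior} g_x g_xᵀ = d₁ᵀd₁ + d₀d₀ᵀ`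
(the Landau/Hodge precision matrix of the registered skeleton v9 `f1519a877fd86581` of planner `ym-idea-2`, copied verbatim into
`Theorems/AllWindowsColdBoxBoxHighWindowsSU22LineDefs.lean`).  So `λ_min(hodgeQ H)·H² ≥ 1/344` uniformly in `H` — the registered
obligation `HodgePoincareColdBox` (`∃ c > 0, ∀ H ≥ 1, ∀ v, c/H²·(v·v) ≤ v·(hodgeQ H v)`), with the crude but honest `c = 1/344`
(instrument I20: `λ_min·H² = 2.13 … 5.17` for `H = 2 … 8`, limit `3π²/4`).

Proof (parts 1–4 are the Mathlib-only files `…HodgePoincare{BoxSums,Core,Faces,Fun}`; this file is the bridge):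
* the quadratic form of `hodgeQ` is the plaquette energy `Σ_p circ_p(u)²` of the zero extension `u = glue 0 v` over all plaquettes
  based in `[-2,2H+2]⁴` plus the divergence energy `Σ_{x ∈ [1,2H−1]⁴} (Σ_i u(x−e_i,i) − u(x,i))²` (`dotProduct_hodgeQ_eq`: the
  translated plaquette set of the enlarged block versus the box sum differ only by plaquettes with zero circulation; the gauge mode
  `g_x` pairs with `v` to inflow minus outflow at `x`);
* `norm_sq_le_hodge` (part 4) bounds `Σ_e u_e² ≤ 86·N²·(that form)`, `N = 2H`: split the box edges into CORE edges (every transverse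
  coordinate in `[1,N−1]`) and FACE-TANGENTIAL edges; the latter own exterior plaquettes (`‖u − u_core‖² ≤ Σ circ²`), the former obey
  the div–curl energy identity with identically vanishing boundary cross terms and the one-dimensional Dirichlet Poincaré inequality
  in their three transverse directions; a per-plaquette convexity inequality glues the two.
No Fourier analysis, no face bound state, no comparison with the componentwise Dirichlet Laplacian (which is false uniformly in `H`
by the planner's I20c) is used.  Everything proved; standard axioms only.
HONEST LABEL: ONE registered stub (S1, size M) of a critic-PASSed DRAFT-by-design line on the R2ξ″ all-windows crux ⟨24004⟩ / its low
item ⟨24335⟩; the line's load-bearing stubs S4b/S5 (and S3, S4) remain open; no crux, rung or summit is proved; the Yang–Mills mass gap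
is NOT proved by this file.
-/

set_option autoImplicit false

namespace Summit.QuantumFields.YangMills.Theorems.AllWindowsColdBoxBoxHighLine

open Finset Matrix
open Literature.Probability.LatticeModels (Site mem_halfOpenBox halfOpenBox)
open Literature.MathematicalPhysics.QuantumFieldTheory
open Literature.MathematicalPhysics.QuantumFieldTheory.LatticeMaxwell
open Literature.MathematicalPhysics.QuantumFieldTheory.AxialGauge
open Summit.QuantumFields.YangMills.Theorems.WeakCouplingRates
open HodgePoincare

/-! ## Part 5: from edge functions on `ℤ⁴` to the Hodge precision matrix of the cold box -/

/-- The zero-extended edge function of a free configuration is supported on the edges of the cube `[0, 2H]⁴`. -/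
theorem glue_supp (H : ℕ) (v : LandauFree H → ℝ) (x : Site 4) (i : Fin 4)
    (h : glue (pin := landauPin H) dirCorner (2 * H + 3) 0 v (x, i) ≠ 0) :
    (∀ k, 0 ≤ x k ∧ x k ≤ ((2 * H : ℕ) : ℤ)) ∧ x i + 1 ≤ ((2 * H : ℕ) : ℤ) := by
  have hmem : (x, i) ∈ boxEdges 4 (2 * H + 1) := by
    by_contra hnot
    by_cases hblock : (x, i) ∈ boxEdgesAt dirCorner (2 * H + 3)
    · exact h (by rw [glue_apply_pin (pin := landauPin H) 0 v hblock hnot]; rfl)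
    · exact h (glue_apply_of_not_mem (pin := landauPin H) 0 v hblock)
  rw [mem_boxEdges_iff] at hmem
  push_cast
  exact ⟨fun k => by have := hmem.1 k; constructor <;> omega, by have := hmem.2; omega⟩

/-- The squared norm of a free configuration is at most the box sum of its squared zero extension. -/
theorem dotProduct_self_le_sum_glue (H : ℕ) (v : LandauFree H → ℝ) :
    v ⬝ᵥ v ≤ ∑ x ∈ Fintype.piFinset (fun _ : Fin 4 => Finset.Icc (-2 : ℤ) (((2 * H : ℕ) : ℤ) + 2)), ∑ i : Fin 4,
      glue (pin := landauPin H) dirCorner (2 * H + 3) 0 v (x, i) ^ 2 := by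
  classical
  have h1 : v ⬝ᵥ v = ∑ e : LandauFree H, glue (pin := landauPin H) dirCorner (2 * H + 3) 0 v e.1.1 ^ 2 := by
    simp only [dotProduct]
    exact Finset.sum_congr rfl fun e _ => by rw [glue_apply_free]; ring
  rw [h1]
  have hinj : Set.InjOn (fun e : LandauFree H => e.1.1) (Finset.univ : Finset (LandauFree H)) :=
    fun a _ b _ hab => Subtype.ext (Subtype.ext hab)
  rw [← Finset.sum_image (f := fun e' => glue (pin := landauPin H) dirCorner (2 * H + 3) 0 v e' ^ 2) hinj,
    ← Finset.sum_product (s := Fintype.piFinset (fun _ : Fin 4 => Finset.Icc (-2 : ℤ) (((2 * H : ℕ) : ℤ) + 2)))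
      (t := (Finset.univ : Finset (Fin 4)))
      (f := fun e' => glue (pin := landauPin H) dirCorner (2 * H + 3) 0 v e' ^ 2)]
  refine Finset.sum_le_sum_of_subset_of_nonneg (fun e' he' => ?_) fun _ _ _ => sq_nonneg _
  obtain ⟨e, -, rfl⟩ := Finset.mem_image.1 he'
  rw [Finset.mem_product]
  refine ⟨?_, Finset.mem_univ _⟩
  have hb := mem_boxEdgesAt.1 e.1.2
  rw [mem_boxEdges_iff] at hb
  rw [mem_box]
  intro k
  have := hb.1 k
  simp only [Pi.sub_apply, dirCorner] at this
  push_cast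
  constructor <;> omega

/-- Membership in the translated plaquette set of the enlarged block, in coordinates. -/
theorem mem_image_shift_iff (H : ℕ) (q : Plaq 4) :
    q ∈ (plaquettesIn (halfOpenBox 4 (2 * H + 3))).image (Plaq.shift dirCorner) ↔
      q.2.1 < q.2.2 ∧ (∀ k, -1 ≤ q.1 k ∧ q.1 k ≤ 2 * (H : ℤ) + 1) ∧
        (∀ k, (q.1 + Pi.single q.2.1 1 + Pi.single q.2.2 1 : Site 4) k ≤ 2 * (H : ℤ) + 1) := by
  constructor
  · intro hq
    obtain ⟨p, hp, rfl⟩ := Finset.mem_image.1 hq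
    rw [Plaq.mem_plaquettesIn] at hp
    obtain ⟨h1, h2, -, -, h5⟩ := hp
    rw [mem_halfOpenBox] at h1 h5
    refine ⟨h2, fun k => ?_, fun k => ?_⟩
    · have := h1 k
      simp only [Plaq.shift_fst, Pi.add_apply, dirCorner]
      constructor <;> omega
    · have := h5 k
      simp only [Pi.add_apply] at this
      simp only [Plaq.shift_fst, Plaq.shift_snd, Pi.add_apply, dirCorner]
      omega
  · rintro ⟨h2, h1, h5⟩
    refine Finset.mem_image.2 ⟨(q.1 - dirCorner, q.2), ?_, ?_⟩
    · rw [Plaq.mem_plaquettesIn]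
      have hei := HodgePoincare.single_one_apply_bounds q.2.1
      have hej := HodgePoincare.single_one_apply_bounds q.2.2
      refine ⟨?_, h2, ?_, ?_, ?_⟩ <;> rw [mem_halfOpenBox] <;> intro k <;> have a1 := h1 k <;> have a5 := h5 k <;>
        have b1 := hei k <;> have b2 := hej k <;>
        simp only [Pi.sub_apply, Pi.add_apply, dirCorner] at a5 ⊢ <;> push_cast <;> constructor <;> omega
    · simp [Plaq.shift]

/-- A plaquette with non-zero circulation of a box-supported edge function has its base point in `[-1, 2H]⁴`. -/
theorem base_bounds_of_sCirc_ne_zero (H : ℕ) (u : Literature.MathematicalPhysics.QuantumLattice.ZdEdge 4 → ℝ)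
    (hsupp : ∀ x i, u (x, i) ≠ 0 → (∀ k, 0 ≤ x k ∧ x k ≤ ((2 * H : ℕ) : ℤ)) ∧ x i + 1 ≤ ((2 * H : ℕ) : ℤ))
    (q : Plaq 4) (hne : sCirc u q ≠ 0) : ∀ k, -1 ≤ q.1 k ∧ q.1 k ≤ 2 * (H : ℤ) := by
  have hei := HodgePoincare.single_one_apply_bounds q.2.1
  have hej := HodgePoincare.single_one_apply_bounds q.2.2
  by_contra hcon
  obtain ⟨k, hk⟩ := not_forall.1 hcon
  apply hne
  simp only [sCirc]
  have z1 : u (q.1, q.2.1) = 0 := by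
    by_contra h; have := (hsupp _ _ h).1 k; push_cast at this; omega
  have z2 : u (q.1 + Pi.single q.2.1 1, q.2.2) = 0 := by
    by_contra h
    have a := (hsupp _ _ h).1 k; have b := hei k
    simp only [Pi.add_apply] at a; push_cast at a; omega
  have z3 : u (q.1 + Pi.single q.2.2 1, q.2.1) = 0 := by
    by_contra h
    have a := (hsupp _ _ h).1 k; have b := hej k
    simp only [Pi.add_apply] at a; push_cast at a; omega
  have z4 : u (q.1, q.2.2) = 0 := by
    by_contra h; have := (hsupp _ _ h).1 k; push_cast at this; omega
  rw [z1, z2, z3, z4]; ring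

/-- **Maxwell part**: the quadratic form of `Qmat` is the plaquette energy of the zero extension over the cube `[-2, 2H+2]⁴`. -/
theorem dotProduct_Qmat_eq_boxSum (H : ℕ) (v : LandauFree H → ℝ)
    (u : Literature.MathematicalPhysics.QuantumLattice.ZdEdge 4 → ℝ)
    (hu : u = glue (pin := landauPin H) dirCorner (2 * H + 3) 0 v) :
    v ⬝ᵥ (Qmat (landauPin H) dirCorner (2 * H + 3) *ᵥ v) =
      ∑ z ∈ Fintype.piFinset (fun _ : Fin 4 => Finset.Icc (-2 : ℤ) (((2 * H : ℕ) : ℤ) + 2)), ∑ i : Fin 4, ∑ j : Fin 4,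
          (if i < j then (u (z, i) + u (z + Pi.single i 1, j) - u (z + Pi.single j 1, i) - u (z, j)) ^ 2 else 0) := by
  have hsupp : ∀ x i, u (x, i) ≠ 0 → (∀ k, 0 ≤ x k ∧ x k ≤ ((2 * H : ℕ) : ℤ)) ∧ x i + 1 ≤ ((2 * H : ℕ) : ℤ) := by
    intro x i h; rw [hu] at h; exact glue_supp H v x i h
  have himg : ∑ q ∈ (plaquettesIn (halfOpenBox 4 (2 * H + 3))).image (Plaq.shift dirCorner), sCirc u q ^ 2 =
      ∑ p ∈ plaquettesIn (halfOpenBox 4 (2 * H + 3)), sCirc u (Plaq.shift dirCorner p) ^ 2 :=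
    Finset.sum_image fun p _ q _ hpq => Plaq.shift_injective _ hpq
  rw [dotProduct_Qmat_mulVec, formM, ← hu, ← himg]
  have hT : ∑ z ∈ Fintype.piFinset (fun _ : Fin 4 => Finset.Icc (-2 : ℤ) (((2 * H : ℕ) : ℤ) + 2)), ∑ i : Fin 4, ∑ j : Fin 4,
      (if i < j then (u (z, i) + u (z + Pi.single i 1, j) - u (z + Pi.single j 1, i) - u (z, j)) ^ 2 else 0) =
      ∑ q ∈ (Fintype.piFinset (fun _ : Fin 4 => Finset.Icc (-2 : ℤ) (((2 * H : ℕ) : ℤ) + 2)) ×ˢ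
        ((Finset.univ : Finset (Fin 4)) ×ˢ (Finset.univ : Finset (Fin 4)))).filter (fun q => q.2.1 < q.2.2),
        sCirc u q ^ 2 := by
    rw [Finset.sum_filter, Finset.sum_product]
    refine Finset.sum_congr rfl fun z _ => ?_
    rw [Finset.sum_product]
    refine Finset.sum_congr rfl fun i _ => Finset.sum_congr rfl fun j _ => ?_
    simp only [sCirc]
  rw [hT]
  symm
  refine sum_eq_sum_of_support fun q hq => ?_
  have hne : sCirc u q ≠ 0 := fun h => hq (by rw [h]; ring)
  have hbase := base_bounds_of_sCirc_ne_zero H u hsupp q hne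
  rw [Finset.mem_filter, Finset.mem_product, Finset.mem_product, mem_box, mem_image_shift_iff]
  have hei := HodgePoincare.single_one_apply_bounds q.2.1
  have hej := HodgePoincare.single_one_apply_bounds q.2.2
  constructor
  · rintro ⟨⟨-, -, -⟩, hlt⟩
    refine ⟨hlt, fun k => by have := hbase k; constructor <;> omega, fun k => ?_⟩
    have h1 := hbase k
    have h2 := HodgePoincare.single_add_single_apply_bounds (ne_of_lt hlt) k
    simp only [Pi.add_apply] at h2 ⊢
    omega
  · rintro ⟨hlt, -, -⟩
    refine ⟨⟨fun k => ?_, Finset.mem_univ _, Finset.mem_univ _⟩, hlt⟩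
    have := hbase k; push_cast; constructor <;> omega

/-- Inflow of the zero extension at a site: `Σ_i u(x − e_i, i) = Σ_e v_e · 𝟙[head(e) = x]`. -/
theorem sum_in_eq (H : ℕ) (v : LandauFree H → ℝ) (x : Site 4) :
    ∑ i : Fin 4, glue (pin := landauPin H) dirCorner (2 * H + 3) 0 v (x - Pi.single i 1, i) =
      ∑ e : LandauFree H, v e * (if e.1.1.1 + Pi.single e.1.1.2 1 = x then (1 : ℝ) else 0) := by
  simp only [glue_zero_eq_sum]
  rw [Finset.sum_comm]
  refine Finset.sum_congr rfl fun e _ => ?_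
  rw [← Finset.mul_sum]
  congr 1
  have key : ∀ i : Fin 4, (e.1.1 = (x - Pi.single i 1, i)) ↔ (i = e.1.1.2 ∧ e.1.1.1 + Pi.single e.1.1.2 1 = x) := by
    intro i
    constructor
    · intro h
      have h2 : e.1.1.2 = i := by rw [h]
      refine ⟨h2.symm, ?_⟩
      have h1 : e.1.1.1 = x - Pi.single i 1 := by rw [h]
      rw [h1, h2]; abel
    · rintro ⟨h2, h1⟩
      subst h2
      refine Prod.ext ?_ rfl
      rw [← h1]; simp
  simp only [key]
  by_cases hP : e.1.1.1 + Pi.single e.1.1.2 1 = x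
  · simp only [hP, and_true, if_true]
    rw [Finset.sum_ite_eq']; simp
  · simp only [hP, and_false, if_false, Finset.sum_const_zero]

/-- Outflow of the zero extension at a site: `Σ_i u(x, i) = Σ_e v_e · 𝟙[tail(e) = x]`. -/
theorem sum_out_eq (H : ℕ) (v : LandauFree H → ℝ) (x : Site 4) :
    ∑ i : Fin 4, glue (pin := landauPin H) dirCorner (2 * H + 3) 0 v (x, i) =
      ∑ e : LandauFree H, v e * (if e.1.1.1 = x then (1 : ℝ) else 0) := by
  simp only [glue_zero_eq_sum]
  rw [Finset.sum_comm]
  refine Finset.sum_congr rfl fun e _ => ?_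
  rw [← Finset.mul_sum]
  congr 1
  have key : ∀ i : Fin 4, (e.1.1 = (x, i)) ↔ (i = e.1.1.2 ∧ e.1.1.1 = x) := by
    intro i
    constructor
    · intro h; exact ⟨by rw [h], by rw [h]⟩
    · rintro ⟨h2, h1⟩; subst h2; exact Prod.ext h1 rfl
  simp only [key]
  by_cases hP : e.1.1.1 = x
  · simp only [hP, and_true, if_true]
    rw [Finset.sum_ite_eq']; simp
  · simp only [hP, and_false, if_false, Finset.sum_const_zero]

/-- The gauge mode of a site paired with a free configuration is the (inflow minus outflow) of the zero extension. -/
theorem gradVec_dotProduct_eq (H : ℕ) (v : LandauFree H → ℝ) (x : Site 4) :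
    gradVec H x ⬝ᵥ v = ∑ i : Fin 4, (glue (pin := landauPin H) dirCorner (2 * H + 3) 0 v (x - Pi.single i 1, i) -
      glue (pin := landauPin H) dirCorner (2 * H + 3) 0 v (x, i)) := by
  rw [Finset.sum_sub_distrib, sum_in_eq, sum_out_eq, dotProduct, ← Finset.sum_sub_distrib]
  refine Finset.sum_congr rfl fun e _ => ?_
  rw [gradVec]; ring

/-- **Gauge part**: the quadratic form of `Σ_x g_x g_xᵀ` is the interior divergence energy of the zero extension. -/
theorem dotProduct_gauge_eq_boxSum (H : ℕ) (v : LandauFree H → ℝ) :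
    v ⬝ᵥ ((∑ x ∈ interiorSites H, vecMulVec (gradVec H x) (gradVec H x)) *ᵥ v) =
      ∑ x ∈ Fintype.piFinset (fun _ : Fin 4 => Finset.Icc (1 : ℤ) (((2 * H : ℕ) : ℤ) - 1)),
        (∑ i : Fin 4, (glue (pin := landauPin H) dirCorner (2 * H + 3) 0 v (x - Pi.single i 1, i) -
          glue (pin := landauPin H) dirCorner (2 * H + 3) 0 v (x, i))) ^ 2 := by
  rw [Matrix.sum_mulVec, dotProduct_sum, interiorSites]
  have hcast : (2 * (H : ℤ) - 1) = (((2 * H : ℕ) : ℤ) - 1) := by push_cast; ring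
  rw [hcast]
  refine Finset.sum_congr rfl fun x _ => ?_
  have h1 : vecMulVec (gradVec H x) (gradVec H x) *ᵥ v = (gradVec H x ⬝ᵥ v) • gradVec H x := by
    ext e
    simp only [Matrix.mulVec, vecMulVec_apply, dotProduct, Pi.smul_apply, smul_eq_mul, Finset.sum_mul]
    exact Finset.sum_congr rfl fun e' _ => by ring
  rw [h1, dotProduct_smul, smul_eq_mul, dotProduct_comm v (gradVec H x), ← sq, gradVec_dotProduct_eq]

/-- **The Hodge form as plaquette energy plus interior divergence energy of the zero extension.** -/
theorem dotProduct_hodgeQ_eq (H : ℕ) (v : LandauFree H → ℝ) :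
    v ⬝ᵥ (hodgeQ H *ᵥ v) =
      ∑ z ∈ Fintype.piFinset (fun _ : Fin 4 => Finset.Icc (-2 : ℤ) (((2 * H : ℕ) : ℤ) + 2)), ∑ i : Fin 4, ∑ j : Fin 4,
          (if i < j then (glue (pin := landauPin H) dirCorner (2 * H + 3) 0 v (z, i) +
            glue (pin := landauPin H) dirCorner (2 * H + 3) 0 v (z + Pi.single i 1, j) -
            glue (pin := landauPin H) dirCorner (2 * H + 3) 0 v (z + Pi.single j 1, i) -
            glue (pin := landauPin H) dirCorner (2 * H + 3) 0 v (z, j)) ^ 2 else 0) +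
        ∑ x ∈ Fintype.piFinset (fun _ : Fin 4 => Finset.Icc (1 : ℤ) (((2 * H : ℕ) : ℤ) - 1)),
          (∑ i : Fin 4, (glue (pin := landauPin H) dirCorner (2 * H + 3) 0 v (x - Pi.single i 1, i) -
            glue (pin := landauPin H) dirCorner (2 * H + 3) 0 v (x, i))) ^ 2 := by
  rw [hodgeQ, Matrix.add_mulVec, dotProduct_add, dotProduct_Qmat_eq_boxSum H v _ rfl, dotProduct_gauge_eq_boxSum]

/-- **λ_min(hodgeQ H) ≥ 1/(344 H²)**: the quantitative Hodge–Poincaré inequality of the cold box (`H ≥ 1`). -/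
theorem hodgeQ_poincare (H : ℕ) (hH : 1 ≤ H) (v : LandauFree H → ℝ) :
    v ⬝ᵥ v ≤ 344 * (H : ℝ) ^ 2 * (v ⬝ᵥ (hodgeQ H *ᵥ v)) := by
  have hsupp : ∀ x i, glue (pin := landauPin H) dirCorner (2 * H + 3) 0 v (x, i) ≠ 0 →
      (∀ k, 0 ≤ x k ∧ x k ≤ ((2 * H : ℕ) : ℤ)) ∧ x i + 1 ≤ ((2 * H : ℕ) : ℤ) :=
    fun x i h => glue_supp H v x i h
  have key := norm_sq_le_hodge (2 * H) (by omega)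
    (fun e => glue (pin := landauPin H) dirCorner (2 * H + 3) 0 v e) hsupp
  rw [← dotProduct_hodgeQ_eq H v] at key
  have h1 := dotProduct_self_le_sum_glue H v
  have hcast : ((2 * H : ℕ) : ℝ) = 2 * (H : ℝ) := by push_cast; ring
  rw [hcast] at key
  nlinarith [key, h1]

/-- **Registered stub S1 of LINE-19 «landau-sector-relative-bl» (crux `AllWindowsColdBox.BoxHighWindowsSU22`,
stmt-QuantumFields-24004; low item stmt-QuantumFields-24335), BY NAME**: the Hodge–Poincaré inequality of the cold box,
`λ_min(hodgeQ H) ≥ c/H²` with `c = 1/344`. -/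
theorem stub_hodgePoincare : HodgePoincareColdBox := by
  refine ⟨1 / 344, by norm_num, fun H hH v => ?_⟩
  have h := hodgeQ_poincare H hH v
  have hH' : (0 : ℝ) < (H : ℝ) ^ 2 := by
    have : (1 : ℝ) ≤ H := by exact_mod_cast hH
    positivity
  rw [div_mul_eq_mul_div, div_le_iff₀ hH']
  linarith

/-- **Strict positivity of the Hodge form from S1** (appended, fcl-p3 g23): for `H ≥ 1` and `v ≠ 0`, `0 < vᵀ · hodgeQ H · v`
(immediate from `hodgeQ_poincare`; independent of the S2 route `hodgeQ_posDef`). -/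
theorem dotProduct_hodgeQ_pos (H : ℕ) (hH : 1 ≤ H) (v : LandauFree H → ℝ) (hv : v ≠ 0) :
    0 < v ⬝ᵥ (hodgeQ H *ᵥ v) := by
  have h := hodgeQ_poincare H hH v
  have hvv : 0 < v ⬝ᵥ v := by
    obtain ⟨e, he⟩ : ∃ e, v e ≠ 0 := by
      by_contra hne
      push Not at hne
      exact hv (funext hne)
    have h1 : v e * v e ≤ v ⬝ᵥ v := by
      rw [dotProduct]
      exact Finset.single_le_sum (f := fun i => v i * v i) (fun i _ => mul_self_nonneg (v i)) (Finset.mem_univ e)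
    have h2 : 0 < v e * v e := mul_self_pos.2 he
    linarith
  have hH' : (0 : ℝ) < 344 * (H : ℝ) ^ 2 := by
    have : (1 : ℝ) ≤ H := by exact_mod_cast hH
    positivity
  by_contra hle
  push Not at hle
  have : 344 * (H : ℝ) ^ 2 * (v ⬝ᵥ (hodgeQ H *ᵥ v)) ≤ 0 := mul_nonpos_of_nonneg_of_nonpos hH'.le hle
  linarith

/-- **S1 with the constant exposed** (appended, fcl-p3 g23; the registered Prop `HodgePoincareColdBox` hides `c` behind `∃`):
for every `H ≥ 1` and `v`, `(v·v) / (344·H²) ≤ vᵀ · hodgeQ H · v`.  This is the form consumers of S1 on the LOW item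
⟨stmt-QuantumFields-24335⟩ `BoxWindowLowSU2213` quote. -/
theorem hodgePoincare_explicit (H : ℕ) (hH : 1 ≤ H) (v : LandauFree H → ℝ) :
    (v ⬝ᵥ v) / (344 * (H : ℝ) ^ 2) ≤ v ⬝ᵥ (hodgeQ H *ᵥ v) := by
  have h := hodgeQ_poincare H hH v
  have hH' : (0 : ℝ) < 344 * (H : ℝ) ^ 2 := by
    have : (1 : ℝ) ≤ H := by exact_mod_cast hH
    positivity
  rw [div_le_iff₀ hH']
  linarith

end Summit.QuantumFields.YangMills.Theorems.AllWindowsColdBoxBoxHighLine
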